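import Literature.Analysis.Convex.Subgradient
import Mathlib.Analysis.InnerProductSpace.EuclideanDist
import Mathlib.Topology.MetricSpace.ProperSpace.Lemmas
import HarnessLib

/-!
# The proximal map of a finite convex function (Moreau's resolvent `(I + ∂f)⁻¹`)

Let `E` be a finite-dimensional real inner product space and `f : E → ℝ` convex (on all of `E`;
it is then continuous). For every `x : E` the strongly convex function
`z ↦ f z + ‖z - x‖² / 2` has a unique minimiser, the **proximal point** `prox f x` (the minimiser
in the infimal convolution of `f` with the kernel `½‖·‖²`, the *Moreau–Yosida regularisation*:
Hiriart-Urruty–Lemaréchal 2001, Chap. E, Example 2.1.4; Moreau 1965). It is characterised by the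
inclusion `x - prox f x ∈ ∂f(prox f x)` (so `prox f = (I + ∂f)⁻¹`, the *resolvent* of the
subdifferential), it is onto, and it is `1`-Lipschitz (indeed firmly non-expansive), by the
monotonicity of `∂f`.

This is the device by which Alexandrov's theorem (a convex function is twice differentiable a.e.,
Evans–Gariepy Thm. 6.9) is reduced to Rademacher's theorem in
`Literature/Analysis/Convex/AlexandrovTheorem.lean` (Mignot's argument), a brick of the proof of
`Literature.Geometry.Lorentzian.ChruscielEtAl2001_areaTheorem`.

## Main results (all proved)

* `exists_isMinOn_proxFun`, `IsMinOn.eq_of_isMinOn_proxFun` — existence and uniqueness of the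
  minimiser of `proxFun f x = f + ‖· - x‖²/2`;
* `isMinOn_proxFun_iff` — `y` minimises iff `x - y` is a subgradient of `f` at `y`;
* `prox`, `hasSubgradientWithinAt_prox`, `prox_eq_iff`, `prox_add_of_hasSubgradientWithinAt`
  (`prox f (y + p) = y` for `p ∈ ∂f(y)`), `prox_surjective`;
* `norm_prox_sub_prox_sq_le`, `norm_prox_sub_prox_le`, `lipschitzWith_prox`, `continuous_prox`.

## References

* J.-B. Hiriart-Urruty, C. Lemaréchal, *Fundamentals of Convex Analysis*, Springer 2001, Chap. E,
  Example 2.1.4 (Moreau–Yosida regularisation; held copy PDF p. 220), Chap. D, Prop. 6.1.1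
  (monotonicity of `∂f`, PDF p. 195). Key `HiriarturrutyLemarechal2001`.
* J.-J. Moreau, *Proximité et dualité dans un espace hilbertien*, Bull. Soc. Math. France 93
  (1965) 273–299 (the proximal map, firm non-expansiveness).
* R. T. Rockafellar, *Convex Analysis*, Princeton 1970, §31 (Moreau's theorem). Key
  `Rockafellar1970`.
-/

noncomputable section

open Set Filter Metric Topology InnerProductSpace
open scoped RealInnerProductSpace

namespace Literature.Analysis.Convex

variable {E : Type*} [NormedAddCommGroup E] [InnerProductSpace ℝ E]

/-! ### The proximal functional and its minimisers -/

/-- The **proximal functional** of `f` based at `x`: `z ↦ f z + ‖z - x‖² / 2` (the function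
minimised in the Moreau–Yosida regularisation of `f` at `x`, Hiriart-Urruty–Lemaréchal 2001,
Chap. E, Example 2.1.4). [cite: HiriarturrutyLemarechal2001, Chap. E, Example 2.1.4 (PDF p. 220)] -/
def proxFun (f : E → ℝ) (x : E) (z : E) : ℝ := f z + ‖z - x‖ ^ 2 / 2

variable {f : E → ℝ} {x y z p : E}

omit [InnerProductSpace ℝ E] in
/-- Unfolding lemma. [folklore] -/
@[simp] theorem proxFun_apply (f : E → ℝ) (x z : E) : proxFun f x z = f z + ‖z - x‖ ^ 2 / 2 := rfl

/-- The polarisation identity behind all estimates of this file: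
`‖z - x‖² = ‖z - y‖² + 2⟪z - y, y - x⟫ + ‖y - x‖²`. [folklore] -/
theorem norm_sub_sq_eq_of_mid (x y z : E) :
    ‖z - x‖ ^ 2 = ‖z - y‖ ^ 2 + 2 * ⟪z - y, y - x⟫ + ‖y - x‖ ^ 2 := by
  have h : z - x = (z - y) + (y - x) := by abel
  rw [h, ← real_inner_self_eq_norm_sq, ← real_inner_self_eq_norm_sq, ← real_inner_self_eq_norm_sq]
  simp only [inner_add_left, inner_add_right, real_inner_comm (y - x) (z - y)]
  ring

/-- **Sufficiency of the subgradient condition**: if `x - y` is a subgradient of `f` at `y`, then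
`y` minimises the proximal functional, indeed `proxFun f x y + ‖z - y‖²/2 ≤ proxFun f x z`
(strong convexity). [folklore] -/
theorem HasSubgradientWithinAt.proxFun_add_le (h : HasSubgradientWithinAt f univ (x - y) y)
    (z : E) : proxFun f x y + ‖z - y‖ ^ 2 / 2 ≤ proxFun f x z := by
  have h1 : f y + ⟪x - y, z - y⟫ ≤ f z := h z (mem_univ z)
  have h2 := norm_sub_sq_eq_of_mid x y z
  have h3 : ⟪z - y, y - x⟫ = -⟪x - y, z - y⟫ := by
    rw [real_inner_comm, ← neg_sub x y, inner_neg_left]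
  simp only [proxFun_apply]
  nlinarith [h1, h2, h3]

/-- If `x - y ∈ ∂f(y)` then `y` minimises `proxFun f x`. [folklore] -/
theorem HasSubgradientWithinAt.isMinOn_proxFun (h : HasSubgradientWithinAt f univ (x - y) y) :
    IsMinOn (proxFun f x) univ y := fun z _ ↦ by
  have := h.proxFun_add_le z
  have h0 : 0 ≤ ‖z - y‖ ^ 2 / 2 := by positivity
  show proxFun f x y ≤ proxFun f x z
  linarith

/-- **Necessity of the subgradient condition** (first-order optimality for the strongly convex
proximal functional): if `f` is convex and `y` minimises `proxFun f x`, then `x - y ∈ ∂f(y)`.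
Proof: compare the values at `y` and at `y + t (z - y)`, `t ∈ (0, 1]`, use convexity of `f` along
the segment, divide by `t` and let `t → 0`. [folklore] -/
theorem IsMinOn.hasSubgradientWithinAt_of_proxFun (hf : ConvexOn ℝ univ f)
    (hy : IsMinOn (proxFun f x) univ y) : HasSubgradientWithinAt f univ (x - y) y := by
  intro z _
  -- `0 ≤ f z - f y + ⟪y - x, z - y⟫ + t ‖z - y‖² / 2` for all `t ∈ (0, 1]`
  have key : ∀ t : ℝ, 0 < t → t ≤ 1 →
      0 ≤ f z - f y + ⟪y - x, z - y⟫ + t * (‖z - y‖ ^ 2 / 2) := by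
    intro t ht0 ht1
    have hmin : proxFun f x y ≤ proxFun f x (y + t • (z - y)) := hy (mem_univ _)
    have hconv := hf.2 (mem_univ y) (mem_univ z) (by linarith : 0 ≤ 1 - t) ht0.le (by ring)
    have hpt : (1 - t) • y + t • z = y + t • (z - y) := by
      simp only [sub_smul, one_smul, smul_sub]; abel
    rw [hpt, smul_eq_mul, smul_eq_mul] at hconv
    -- expand the quadratic term at `y + t • (z - y)`
    have hq : ‖y + t • (z - y) - x‖ ^ 2 = ‖y - x‖ ^ 2 + 2 * t * ⟪y - x, z - y⟫ + t ^ 2 * ‖z - y‖ ^ 2 := by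
      have e : y + t • (z - y) - x = (y - x) + t • (z - y) := by abel
      rw [e, ← real_inner_self_eq_norm_sq, ← real_inner_self_eq_norm_sq,
        ← real_inner_self_eq_norm_sq]
      simp only [inner_add_left, inner_add_right, real_inner_smul_left, real_inner_smul_right,
        real_inner_comm (z - y) (y - x)]
      ring
    simp only [proxFun_apply] at hmin
    rw [hq] at hmin
    -- `hmin`: `f y + ‖y-x‖²/2 ≤ f (y + t(z-y)) + (‖y-x‖² + 2t⟪y-x,z-y⟫ + t²‖z-y‖²)/2`
    have h4 : t * (f z - f y + ⟪y - x, z - y⟫ + t * (‖z - y‖ ^ 2 / 2)) ≥ 0 := by nlinarith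
    exact nonneg_of_mul_nonneg_right h4 ht0
  -- let `t → 0`
  have hlim : 0 ≤ f z - f y + ⟪y - x, z - y⟫ := by
    by_contra hneg
    push Not at hneg
    set c := -(f z - f y + ⟪y - x, z - y⟫) with hc
    have hc0 : 0 < c := by rw [hc]; linarith
    set Q := ‖z - y‖ ^ 2 / 2 with hQ
    have hQ0 : 0 ≤ Q := by positivity
    -- choose `t = min 1 (c / (2 (Q + 1)))`
    set t := min 1 (c / (2 * (Q + 1))) with ht
    have ht0 : 0 < t := lt_min one_pos (by positivity)
    have ht1 : t ≤ 1 := min_le_left _ _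
    have htQ : t * Q < c := by
      have h1 : t ≤ c / (2 * (Q + 1)) := min_le_right _ _
      have h2 : t * Q ≤ c / (2 * (Q + 1)) * Q := mul_le_mul_of_nonneg_right h1 hQ0
      have h3 : c / (2 * (Q + 1)) * Q < c := by
        rw [div_mul_eq_mul_div, div_lt_iff₀ (by positivity)]
        nlinarith
      linarith
    have := key t ht0 ht1
    linarith
  have e : ⟪x - y, z - y⟫ = -⟪y - x, z - y⟫ := by rw [← neg_sub y x, inner_neg_left]
  linarith

/-- **Characterisation of the proximal point**: for convex `f`, `y` minimises
`z ↦ f z + ‖z - x‖²/2` iff `x - y` is a subgradient of `f` at `y`. [folklore] -/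
theorem isMinOn_proxFun_iff (hf : ConvexOn ℝ univ f) :
    IsMinOn (proxFun f x) univ y ↔ HasSubgradientWithinAt f univ (x - y) y :=
  ⟨fun h ↦ IsMinOn.hasSubgradientWithinAt_of_proxFun hf h, fun h ↦ h.isMinOn_proxFun⟩

/-- **Uniqueness of the minimiser** of the proximal functional (strong convexity): two minimisers
coincide. [folklore] -/
theorem IsMinOn.eq_of_isMinOn_proxFun (hf : ConvexOn ℝ univ f) {y₁ y₂ : E}
    (h₁ : IsMinOn (proxFun f x) univ y₁) (h₂ : IsMinOn (proxFun f x) univ y₂) : y₁ = y₂ := by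
  have hs₁ := IsMinOn.hasSubgradientWithinAt_of_proxFun hf h₁
  have k₁ := hs₁.proxFun_add_le y₂
  have k₂ : proxFun f x y₂ ≤ proxFun f x y₁ := h₂ (mem_univ _)
  have : ‖y₂ - y₁‖ ^ 2 / 2 ≤ 0 := by linarith
  have h0 : ‖y₂ - y₁‖ ^ 2 = 0 := le_antisymm (by linarith) (by positivity)
  rw [sq_eq_zero_iff, norm_eq_zero, sub_eq_zero] at h0
  exact h0.symm

/-- **Existence of the minimiser** of the proximal functional for a convex function on a
finite-dimensional space: `f` is continuous and has a subgradient `p` at `x`, whence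
`proxFun f x z - f x ≥ ‖z - x‖ (‖z - x‖/2 - ‖p‖) ≥ 0` off the compact ball
`closedBall x (2‖p‖)`, on which the continuous `proxFun f x` attains its minimum. [folklore] -/
theorem exists_isMinOn_proxFun [FiniteDimensional ℝ E] (hf : ConvexOn ℝ univ f) (x : E) :
    ∃ y, IsMinOn (proxFun f x) univ y := by
  haveI : ProperSpace E := FiniteDimensional.proper ℝ E
  have hcont : Continuous f := by
    have := hf.continuousOn isOpen_univ
    exact continuousOn_univ.mp this
  obtain ⟨p, hp⟩ := ConvexOn.exists_hasSubgradientWithinAt_of_finiteDimensional hf isOpen_univ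
    (mem_univ x)
  set R : ℝ := 2 * ‖p‖ with hR
  have hR0 : 0 ≤ R := by positivity
  -- minimum on the compact ball
  have hK : IsCompact (closedBall x R) := isCompact_closedBall x R
  have hgc : Continuous (proxFun f x) := by
    unfold proxFun
    exact hcont.add ((continuous_id.sub continuous_const).norm.pow 2 |>.div_const 2)
  obtain ⟨y, hyK, hymin⟩ :=
    hK.exists_isMinOn ⟨x, mem_closedBall_self hR0⟩ hgc.continuousOn
  refine ⟨y, fun z _ ↦ ?_⟩
  by_cases hz : z ∈ closedBall x R
  · exact hymin hz
  · -- outside the ball the functional exceeds its value at the centre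
    have hzR : R < ‖z - x‖ := by
      rw [mem_closedBall, dist_eq_norm, not_le] at hz; exact hz
    have h1 : f x + ⟪p, z - x⟫ ≤ f z := hp z (mem_univ z)
    have h2 : -(‖p‖ * ‖z - x‖) ≤ ⟪p, z - x⟫ := by
      have := abs_real_inner_le_norm p (z - x)
      have := neg_abs_le ⟪p, z - x⟫
      linarith
    have h3 : proxFun f x x ≤ proxFun f x z := by
      simp only [proxFun_apply, sub_self, norm_zero, ne_eq, OfNat.ofNat_ne_zero, not_false_eq_true,
        zero_pow, zero_div, add_zero]
      nlinarith [norm_nonneg (z - x), norm_nonneg p]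
    show proxFun f x y ≤ proxFun f x z
    exact (hymin (mem_closedBall_self hR0)).trans h3

/-! ### The proximal map -/

open Classical in
/-- The **proximal map** (Moreau's `prox`, the resolvent `(I + ∂f)⁻¹`): `prox f x` is the
minimiser of `z ↦ f z + ‖z - x‖²/2` when one exists (always, for convex `f` on a finite-dimensional
space: `exists_isMinOn_proxFun`), and the junk value `x` otherwise. Hiriart-Urruty–Lemaréchal 2001,
Chap. E, Example 2.1.4 (Moreau–Yosida regularisation); Moreau 1965.
[cite: HiriarturrutyLemarechal2001, Chap. E, Example 2.1.4 (PDF p. 220)] -/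
def prox (f : E → ℝ) (x : E) : E :=
  if h : ∃ y, IsMinOn (proxFun f x) univ y then h.choose else x

/-- `prox f x` minimises the proximal functional (finite dimension, `f` convex). [folklore] -/
theorem isMinOn_prox [FiniteDimensional ℝ E] (hf : ConvexOn ℝ univ f) (x : E) :
    IsMinOn (proxFun f x) univ (prox f x) := by
  have h := exists_isMinOn_proxFun hf x
  rw [prox, dif_pos h]
  exact h.choose_spec

/-- **The resolvent inclusion**: `x - prox f x ∈ ∂f(prox f x)`. [folklore] -/
theorem hasSubgradientWithinAt_prox [FiniteDimensional ℝ E] (hf : ConvexOn ℝ univ f) (x : E) :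
    HasSubgradientWithinAt f univ (x - prox f x) (prox f x) :=
  IsMinOn.hasSubgradientWithinAt_of_proxFun hf (isMinOn_prox hf x)

/-- `prox f x = y` iff `x - y ∈ ∂f(y)` (finite dimension, `f` convex). [folklore] -/
theorem prox_eq_iff [FiniteDimensional ℝ E] (hf : ConvexOn ℝ univ f) :
    prox f x = y ↔ HasSubgradientWithinAt f univ (x - y) y := by
  constructor
  · rintro rfl; exact hasSubgradientWithinAt_prox hf x
  · intro h
    exact IsMinOn.eq_of_isMinOn_proxFun hf (isMinOn_prox hf x) h.isMinOn_proxFun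

/-- **Surjectivity of the proximal map**: if `p ∈ ∂f(y)` then `prox f (y + p) = y`. [folklore] -/
theorem prox_add_of_hasSubgradientWithinAt [FiniteDimensional ℝ E] (hf : ConvexOn ℝ univ f)
    (hp : HasSubgradientWithinAt f univ p y) : prox f (y + p) = y := by
  rw [prox_eq_iff hf, add_sub_cancel_left]
  exact hp

/-- The proximal map of a convex function on a finite-dimensional space is onto (every point has a
subgradient). [folklore] -/
theorem prox_surjective [FiniteDimensional ℝ E] (hf : ConvexOn ℝ univ f) :
    Function.Surjective (prox f) := fun y ↦ by
  obtain ⟨p, hp⟩ := ConvexOn.exists_hasSubgradientWithinAt_of_finiteDimensional hf isOpen_univ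
    (mem_univ y)
  exact ⟨y + p, prox_add_of_hasSubgradientWithinAt hf hp⟩

/-- **Firm non-expansiveness**: `‖prox f x₁ - prox f x₂‖² ≤ ⟪x₁ - x₂, prox f x₁ - prox f x₂⟫`, from
the monotonicity of the subdifferential (Hiriart-Urruty–Lemaréchal 2001, Chap. D, Prop. 6.1.1)
applied to `xᵢ - prox f xᵢ ∈ ∂f(prox f xᵢ)`. Moreau 1965.
[cite: HiriarturrutyLemarechal2001, Chap. D, Prop. 6.1.1 (PDF p. 195)] -/
theorem norm_prox_sub_prox_sq_le [FiniteDimensional ℝ E] (hf : ConvexOn ℝ univ f) (x₁ x₂ : E) :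
    ‖prox f x₁ - prox f x₂‖ ^ 2 ≤ ⟪x₁ - x₂, prox f x₁ - prox f x₂⟫ := by
  have h := (hasSubgradientWithinAt_prox hf x₁).inner_sub_nonneg (hasSubgradientWithinAt_prox hf x₂)
    (mem_univ _) (mem_univ _)
  have e : x₁ - prox f x₁ - (x₂ - prox f x₂) = (x₁ - x₂) - (prox f x₁ - prox f x₂) := by abel
  rw [e, inner_sub_left, real_inner_self_eq_norm_sq] at h
  linarith

/-- **Non-expansiveness of the proximal map**: `‖prox f x₁ - prox f x₂‖ ≤ ‖x₁ - x₂‖`. Moreau 1965.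
[folklore] -/
theorem norm_prox_sub_prox_le [FiniteDimensional ℝ E] (hf : ConvexOn ℝ univ f) (x₁ x₂ : E) :
    ‖prox f x₁ - prox f x₂‖ ≤ ‖x₁ - x₂‖ := by
  have h := norm_prox_sub_prox_sq_le hf x₁ x₂
  have hCS : ⟪x₁ - x₂, prox f x₁ - prox f x₂⟫ ≤ ‖x₁ - x₂‖ * ‖prox f x₁ - prox f x₂‖ :=
    real_inner_le_norm _ _
  by_cases h0 : ‖prox f x₁ - prox f x₂‖ = 0
  · rw [h0]; exact norm_nonneg _
  · have hpos : 0 < ‖prox f x₁ - prox f x₂‖ := lt_of_le_of_ne (norm_nonneg _) (Ne.symm h0)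
    have : ‖prox f x₁ - prox f x₂‖ * ‖prox f x₁ - prox f x₂‖ ≤ ‖x₁ - x₂‖ * ‖prox f x₁ - prox f x₂‖ := by
      nlinarith
    exact le_of_mul_le_mul_right this hpos

/-- The proximal map is `1`-Lipschitz. Moreau 1965. [folklore] -/
theorem lipschitzWith_prox [FiniteDimensional ℝ E] (hf : ConvexOn ℝ univ f) :
    LipschitzWith 1 (prox f) :=
  LipschitzWith.of_dist_le_mul fun x₁ x₂ ↦ by
    simpa [dist_eq_norm] using norm_prox_sub_prox_le hf x₁ x₂

/-- The proximal map is continuous. [folklore] -/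
theorem continuous_prox [FiniteDimensional ℝ E] (hf : ConvexOn ℝ univ f) : Continuous (prox f) :=
  (lipschitzWith_prox hf).continuous

/-- The fibre of the proximal map over `y` is `y + ∂f(y)`: `prox f x = y ↔ x - y ∈ ∂f(y)`, so
`prox f ⁻¹' {y} = (y + ·) '' ∂f(y)`. [folklore] -/
theorem preimage_prox_singleton [FiniteDimensional ℝ E] (hf : ConvexOn ℝ univ f) (y : E) :
    prox f ⁻¹' {y} = (fun p ↦ y + p) '' subdifferentialWithin f univ y := by
  ext x
  simp only [mem_preimage, mem_singleton_iff, mem_image, mem_subdifferentialWithin_iff]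
  constructor
  · intro h
    exact ⟨x - y, (prox_eq_iff hf).mp h, by abel⟩
  · rintro ⟨p, hp, rfl⟩
    exact prox_add_of_hasSubgradientWithinAt hf hp

end Literature.Analysis.Convex

end
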